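import Literature.AlgebraicGeometry.HodgeTheory.ComplexTorusIntegralHodgeClassesCorrespondencePushforwards
import HarnessLib

/-!
# Fulton's Example 16.1.2 (b) on integral Hodge classes: `(γ ⊠ δ) ∘ α = α^*(γ) ⊠ δ`

For a correspondence `α ∈ Hdgᵃ(X × Y, ℤ)` between complex tori and classes `γ ∈ Hdgᵖ(Y, ℤ)`, `δ ∈ Hdg^q(Z, ℤ)`:

* **`integralHodgeClassesCorrComp_integralHodgeClassesCross_right`** — `(γ ⊠ δ) ∘ α = α^*(γ) ⊠ δ`
  (`β ∘ α = p₁₃*(p₁₂^*α · p₂₃^*β)` on `X × (Y × Z)`, `α^*(b) = p_{X*}(α · p_Y^* b)`).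

Proof by transposition from Example 16.1.2 (a) (g27-#10 `integralHodgeClassesCorrComp_integralHodgeClassesCross_left`): `τ_*` is injective
(`τ_* τ_* = 1`), `τ_*((γ ⊠ δ) ∘ α) = α' ∘ (γ ⊠ δ)' = α' ∘ (δ ⊠ γ)` (g27-#6, g27-#3), `α' ∘ (δ ⊠ γ) = δ ⊠ (α')_*(γ)` (Example 16.1.2 (a) on
`Z × (Y × X)`), `(α')_* = α^*` (Prop. 16.1.2 (b), g27-#6) and `τ_*(α^*γ ⊠ δ) = δ ⊠ α^*γ`. Everything is proved; no named fact is introduced (D-0026).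

## References

* [Fulton1998] W. Fulton, *Intersection Theory*, 2nd ed., Springer (1998), §16.1 Example 16.1.2 (a), (b) (p0296 L8–L12), Prop. 16.1.1 (b),
  Prop. 16.1.2 (b) (p0293 L23, p0295 L24–L26).
* [Lange2023AbelianVarietiesComplex] H. Lange, *Abelian Varieties over the Complex Numbers*, Springer (2023), §6.2.2 (p0303 L19–L29, p0304).
-/

noncomputable section

open CategoryTheory Function

namespace Literature.AlgebraicGeometry.HodgeTheory

open Literature.AlgebraicGeometry.Motives Literature.AlgebraicGeometry.Motives.HodgeStructure
open Literature.Geometry.Kaehler Literature.Geometry.Kaehler.ComplexTorus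

namespace ComplexTorusCat

section CrossRight

variable {X Y Z : ComplexTorusCat} {gX gZ gXY gYZ gXZ gT : ℕ} (hggT : gXY + gZ = gT) (hgg₃ : gX + gZ = gXZ)
  (eX : Fin (2 * gX) ≃ X.toIsog.ι) (eZ : Fin (2 * gZ) ≃ Z.toIsog.ι) (eXY : Fin (2 * gXY) ≃ (prodObj X Y).toIsog.ι)
  (eYZ : Fin (2 * gYZ) ≃ (prodObj Y Z).toIsog.ι) (eXZ : Fin (2 * gXZ) ≃ (prodObj X Z).toIsog.ι) (eT : Fin (2 * gT) ≃ (prodObj X (prodObj Y Z)).toIsog.ι)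
  (hgX : gX + gX = 2 * gX) (hgZ : gZ + gZ = 2 * gZ) (hgXY : gXY + gXY = 2 * gXY) (hgYZ : gYZ + gYZ = 2 * gYZ) (hgXZ : gXZ + gXZ = 2 * gXZ)
  (hgT : gT + gT = 2 * gT)
  {a p q r c m t e la lb lZ L l₃ : ℕ} (hpq : p + q = r) (hac : a + r = c) (hap : a + p = t) (hem : e + q = m)
  (hla : la + 2 * a = 2 * gXY) (hlb : lb + 2 * r = 2 * gYZ) (hlZ : lZ + 2 * q = 2 * gZ) (k : L + 2 * t = 2 * gXY) (k' : L + 2 * e = 2 * gX)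
  (h3 : l₃ + 2 * c = 2 * gT) (h3' : l₃ + 2 * m = 2 * gXZ)

include hggT hgg₃ eZ eYZ hgZ hgYZ hla hlb hlZ in
/-- **FULTON'S EXAMPLE 16.1.2 (b) ON INTEGRAL HODGE CLASSES: `(γ ⊠ δ) ∘ α = α^*(γ) ⊠ δ`** for a correspondence `α ∈ Hdgᵃ(X × Y, ℤ)` and
`γ ∈ Hdgᵖ(Y, ℤ)`, `δ ∈ Hdg^q(Z, ℤ)` (`α^*(γ) = p_{X*}(α · p_Y^*γ)`), by transposition from Example 16.1.2 (a).
[cite: Fulton1998, §16.1 Example 16.1.2 (b) (p0296 L11–L12: "(γ × δ) ∘ α = α^*(γ) × δ"), Prop. 16.1.1 (b), Prop. 16.1.2 (b)]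
[cite: Lange2023AbelianVarietiesComplex, §6.2.2 (p0303 L19–L29)] -/
theorem integralHodgeClassesCorrComp_integralHodgeClassesCross_right (α : integralHodgeClasses (prodObj X Y).toIsog.Φ a)
    (γ : integralHodgeClasses Y.toIsog.Φ p) (δ : integralHodgeClasses Z.toIsog.Φ q) :
    integralHodgeClassesPushforward c m (liftHom (fstHom X (prodObj Y Z)) (sndHom X (prodObj Y Z) ≫ sndHom Y Z)) eT eXZ h3 hgT h3' hgXZ
        (integralHodgeClassesCup (prodObj X (prodObj Y Z)).toIsog.Φ hac
          (integralHodgeClassesPullbackHom (liftHom (fstHom X (prodObj Y Z)) (sndHom X (prodObj Y Z) ≫ fstHom Y Z)) a α)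
          (integralHodgeClassesPullbackHom (sndHom X (prodObj Y Z)) r (integralHodgeClassesCross Y Z hpq γ δ))) =
      integralHodgeClassesCross X Z hem
        (integralHodgeClassesPushforward t e (fstHom X Y) eXY eX k hgXY k' hgX
          (integralHodgeClassesCup (prodObj X Y).toIsog.Φ hap α (integralHodgeClassesPullbackHom (sndHom X Y) p γ))) δ := by
  -- `τ_*` is injective (`τ_* τ_* = 1`)
  have hinj : Function.Injective
      (integralHodgeClassesPushforward m m (swapHom X Z) eXZ (eXZ.trans (Equiv.sumComm _ _)) h3' hgXZ h3' hgXZ) := fun u v huv ↦ by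
    rw [← integralHodgeClassesPushforward_swapHom_swapHom X Z eXZ (eXZ.trans (Equiv.sumComm _ _)) h3' hgXZ u, huv,
      integralHodgeClassesPushforward_swapHom_swapHom]
  apply hinj
  rw [integralHodgeClassesPushforward_swapHom_corrComp eXY (eXY.trans (Equiv.sumComm _ _)) eYZ (eYZ.trans (Equiv.sumComm _ _)) eXZ
      (eXZ.trans (Equiv.sumComm _ _)) eT
      (eT.trans ((Equiv.sumAssoc _ _ _).symm.trans ((Equiv.sumComm _ _).trans (Equiv.sumCongr (Equiv.refl _) (Equiv.sumComm _ _)))))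
      hgXY hgYZ hgXZ hgT hac hla hlb h3 h3' α (integralHodgeClassesCross Y Z hpq γ δ),
    integralHodgeClassesPushforward_swapHom_cross Y Z eYZ (eYZ.trans (Equiv.sumComm _ _)) hpq (show q + p = r by omega) hlb hgYZ γ δ,
    integralHodgeClassesPushforward_swapHom_cross X Z eXZ (eXZ.trans (Equiv.sumComm _ _)) hem (show q + e = m by omega) h3' hgXZ _ δ,
    ← integralHodgeClassesPushforward_sndHom_swapHom_cup_pullbackHom_fstHom eX eXY (eXY.trans (Equiv.sumComm _ _)) hgX hgXY hap hla k k' α γ,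
    ← integralHodgeClassesCorrComp_integralHodgeClassesCross_left (by omega : gZ + gXY = gT) (by omega : gZ + gX = gXZ) eZ eX
      (eXY.trans (Equiv.sumComm _ _)) (eXZ.trans (Equiv.sumComm _ _))
      (eT.trans ((Equiv.sumAssoc _ _ _).symm.trans ((Equiv.sumComm _ _).trans (Equiv.sumCongr (Equiv.refl _) (Equiv.sumComm _ _)))))
      hgZ hgX hgXY hgXZ hgT (show q + p = r by omega) (show r + a = c by omega) hap (show q + e = m by omega) hlZ k k' h3 h3' δ γ]

end CrossRight

end ComplexTorusCat

end Literature.AlgebraicGeometry.HodgeTheory
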